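import Summits.QuantumFields.BalabanUV.Beta.FP.ConstrainedBiLaplacianSbJunction
import Summits.QuantumFields.BalabanUV.Beta.FP.ConstrainedBiLaplacianSubcell

/-!
# `BalabanUV.Beta.FP.ConstrainedBiLaplacianSbCellMajorant` — road «FP» for binder row D1, DESIGN ROW **GHOST-STEP** brick (g3) «(CONV-C)-Sb»,
# FILE 5c — Q-FP-13-2's `j`-UNIFORM MAJORANT FOR an2's `Sb` ITSELF: the TWO-LEG SUB-CELL AVERAGE of `Sb_N` (`N = n·L`, cells of level `n`, refinement
# `L`) is `N⁴` times the real part of FILE 1's `latticeKernel (avgM n L 2 τ σ)`, hence bounded by `N⁴·4^{d+1}·Kop·(L^{d+1})⁻¹·e^{−kappaB|X−Y|_∞}` —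
# uniformly in the refinement after the displayed rescaling `× L^{d+1}·N^{−4}`

NOT IN PRINT; OUR PROOF ATTEMPT (binder row G-an2-4 ∕ (CONV-C), prover part P3 = fibre∕strip «Woodbury» lineage, gen 28; CRUX TEAM (2),
2026-08-21).  HONEST DEPENDENCY (cell records, verbatim): «continuum YM on T⁴ ⇐ BetaPertH ∧ nine spine estimates (0/9 proved); BetaPertH ⇐ (D1) ∧
(D4) ∧ CAP+tail; G-an2-4 gates asym, D1 and NE2/3/4.»  HONEST FRAMING (cell contract, verbatim): «discharging `BetaPertH` makes Bałaban's UV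
stability UNCONDITIONAL — a real constructive-QFT result; it is NOT the continuum limit and NOT the Clay problem.»  ABSOLUTE RULE (cell charter,
verbatim): «No internally-minted statement may enter as a cited fact. Every hypothesis is either kernel-proved in this package or a verbatim quotation
of a PUBLISHED theorem with page reference. The manuscript(s) under audit are NOT citable for their own disputed steps — they are the thing under
adjudication; programme-internal (2001/route/tribunal) claims are never citable.»  THIS MODULE is [folklore] bookkeeping over FILE 5b (`Sb_eq_re_KS`) and FILE 1 (`avgM`, `latticeKernel_avgM`,
`subcell_decay`) BY NAME; it cites nothing as a hypothesis, has no `def`, no `def … : Prop`, no `sorry`.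

## Contents

`offset_finePt`, **`Sb_finePt`** (`Sb_N(N•X+τ, N•Y+σ) = Re (N⁴·latticeKernel (M N 2 τ σ) (X − Y))`), **`abs_cellAvg_Sb_le`**:
`|(L^{d+1})⁻²·Σ_{ρρ′} Sb_{nL}((nL)•X + Tsub τ ρ, (nL)•Y + Tsub σ ρ′)| ≤ (nL)⁴·4^{d+1}·Kop (d+1) 2·((L:ℝ)^{d+1})⁻¹·e^{−kappaB (d+1) 2·|X − Y|_∞}` for EVERY
`n, L ≥ 1`, and the packaged **`Sb_cell_tower_uniform`** (`∃ κ > 0, C ≥ 0` free of `n, L`: the doubly cell-averaged kernel times `L^{d+1}·((nL):ℝ)^{−4}` is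
`≤ C·e^{−κ|X−Y|_∞}`).  Read at `n := Lc^m`, `L := Lc^j`: the `j`-uniform exponential majorant of «unit-rescaled `dec (Lc^j) Sb_{Lc^{j+m}}`, both legs
block-averaged» asked in Q-FP-13-2 (d1-p3, 2026-08-21), every power of the scale displayed.

NOT HERE (honest): the convergence ∕ one-step RATE half of Q-FP-13-2.  0∕4 row-D1 binders touched.  NOT (CONV-C), NEVER «G-an2-4 closed», NOT the ghost
step law, NOT SDF, NOT D1, NOT BetaPertH, NOT continuum, NOT Clay.  Provenance: prover-b2b-balaban-gan24-p3-g28-0 (unit `b2b-balaban-gan24-p3`, gen 28),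
2026-08-21; no existing file touched.
-/

noncomputable section

namespace Summit.QuantumFields.BalabanUV.Beta.FP.ConstrainedBiLaplacianSbCellMajorant

open Complex Finset ComplexConjugate MeasureTheory
open Literature.MathematicalPhysics.QuantumFieldTheory
open Literature.MathematicalPhysics.QuantumFieldTheory.Balaban1983to89
open Literature.MathematicalPhysics.QuantumFieldTheory.Balaban1983to89.B4Strip
open Literature.MathematicalPhysics.QuantumFieldTheory.Balaban1983to89.B4StripCauchy
open Literature.MathematicalPhysics.QuantumFieldTheory.Balaban1983to89.B5Strip145Analytic
open Literature.MathematicalPhysics.QuantumFieldTheory.Balaban1983to89.B5Strip145Decay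
open Literature.MathematicalPhysics.QuantumFieldTheory.Balaban1983to89.B4StripSums
open Literature.MathematicalPhysics.QuantumFieldTheory.Balaban1983to89.B4StripSumsHolder (PhZ efZ differentiableAt_PhZ)
open Literature.MathematicalPhysics.QuantumFieldTheory.Balaban1983to89.B4ContourShift
open Literature.MathematicalPhysics.QuantumFieldTheory.Balaban1983to89.B4Green244 (e coarse offset finePt finePt_coarse_offset coarse_finePt
  phaseC V F_zero PhZ_finePt lap_PhZ sum_PhZ_V negLap blockAvg opD opD_latticeKernel latticeKernel_phase_mul latticeKernel_congr
  latticeKernel_sum_mul latticeKernel_one latticeKernel_phase integrableOn_of_differentiableAt sum_rootOfUnity_pow)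
open Summit.QuantumFields.BalabanUV.Beta.FP.ConstrainedBiLaplacianStrip
open Summit.QuantumFields.BalabanUV.Beta.FP.ConstrainedBiLaplacianFibre
open Summit.QuantumFields.BalabanUV.Beta.FP.ConstrainedBiLaplacianFibreEntries
open Summit.QuantumFields.BalabanUV.Beta.FP.ConstrainedBiLaplacianFibreSides
open Summit.QuantumFields.BalabanUV.Beta.FP.ConstrainedBiLaplacianKernel
open Summit.QuantumFields.BalabanUV.Beta.FP.ConstrainedBiLaplacianFibreOperator (Kop Kop_nonneg)
open Summit.QuantumFields.BalabanUV.Beta.FP.ConstrainedBiLaplacianPairing (entry_decay_uniform)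
open Summit.QuantumFields.BalabanUV.Beta.FP.ConstrainedBiLaplacianSubcell (avgM latticeKernel_avgM subcell_decay)
open Summit.QuantumFields.BalabanUV.Beta.FP.ConstrainedBiLaplacianFibreIdentities
open Summit.QuantumFields.BalabanUV.Beta.FP.ConstrainedBiLaplacianResponse
open Summit.QuantumFields.BalabanUV.Beta.FP.ConstrainedBiLaplacianSbFull
open Summit.QuantumFields.BalabanUV.Beta.FP.ConstrainedBiLaplacianSbJunction
open Summit.QuantumFields.BalabanUV.Beta.GAN24.SubAveragingKernel (Tsub)
open Literature.MathematicalPhysics.QuantumFieldTheory.Balaban1983to89.Beta.AffineAveraging (Site Form0 dz codiff₁ unitVec box toSite blockSum)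
open Literature.MathematicalPhysics.QuantumFieldTheory.LatticeForm (quo)
open Literature.MathematicalPhysics.QuantumFieldTheory.Balaban1983to89.Beta.KKTFluctuationUnique (Tempered0)
open Literature.MathematicalPhysics.QuantumFieldTheory.Balaban1983to89.Beta.KernelSpecInstance (re0 re0_apply re1_dz re0_codiff₁)
open Literature.MathematicalPhysics.QuantumFieldTheory.Balaban1983to89.Beta.ScalarBlockGreen (δS)
open Literature.MathematicalPhysics.QuantumFieldTheory.Balaban1983to89.Beta.BiLaplaceBlockKKT (Sb)
open Literature.MathematicalPhysics.QuantumFieldTheory.Balaban1983to89.Beta.BiLaplaceBlockGreen (SolvesB eq_Sb_of_solvesB)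
open scoped Real

variable {d : ℕ}

variable (N : ℕ) [NeZero N]

omit [NeZero N] in
/-- [folklore] `offset (finePt N x j) = j` (the offset of `N x + j` is `j`). -/
theorem offset_finePt [NeZero N] (x : Fin (d + 1) → ℤ) (j : Fin (d + 1) → Fin N) : offset N (finePt N x j) = j := by
  funext ν
  apply Fin.ext
  have hN : (0 : ℤ) < N := by exact_mod_cast Nat.pos_of_ne_zero (NeZero.ne N)
  have hj : ((j ν : ℕ) : ℤ) < N := by exact_mod_cast (j ν).isLt
  show (((N : ℤ) * x ν + ((j ν : ℕ) : ℤ)) % N).toNat = (j ν : ℕ)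
  rw [Int.add_comm, Int.add_mul_emod_self_left, Int.emod_eq_of_lt (by positivity) hj, Int.toNat_natCast]

/-- [folklore] `offset (finePt x j) = j` and `coarse (finePt x j) = x` packaged for `Sb`: the kernel at two fine points given in block coordinates. -/
theorem Sb_finePt (X Y : Fin (d + 1) → ℤ) (τ σ : Fin (d + 1) → Fin N) :
    Sb (N := N) (finePt N X τ) (finePt N Y σ) = (((N : ℂ) ^ 4) * latticeKernel (M N 2 τ σ) (X - Y)).re := by
  rw [Sb_eq_re_KS]
  unfold KS
  rw [coarse_finePt, coarse_finePt, offset_finePt, offset_finePt]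

/-- [our proof] **Q-FP-13-2's `j`-UNIFORM MAJORANT FOR `Sb` ITSELF — THE TWO-LEG SUB-CELL AVERAGE** (FILE 1's `subcell_decay` through the junction):
for `N = n·L`, level-`n` cells `τ, σ`, coarse blocks `X, Y`,
`|(L^{d+1})⁻¹·(L^{d+1})⁻¹·Σ_{ρρ′} Sb_N(N•X + Tsub τ ρ, N•Y + Tsub σ ρ′)| ≤ N⁴·4^{d+1}·Kop (d+1) 2·((L:ℝ)^{d+1})⁻¹·e^{−kappaB (d+1) 2·|X − Y|_∞}` —
the doubly cell-averaged Green kernel times `L^{d+1}·N^{−4}` is bounded UNIFORMLY in the refinement `L` with block-scale exponential decay. -/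
theorem abs_cellAvg_Sb_le (n L : ℕ) [NeZero n] [NeZero L] [NeZero (n * L)] (X Y : Fin (d + 1) → ℤ) (τ σ : Fin (d + 1) → Fin n) :
    |((L : ℝ) ^ (d + 1))⁻¹ * (((L : ℝ) ^ (d + 1))⁻¹ *
        ∑ ρ : Fin (d + 1) → Fin L, ∑ ρ' : Fin (d + 1) → Fin L,
          Sb (N := n * L) (finePt (n * L) X (Tsub n L τ ρ)) (finePt (n * L) Y (Tsub n L σ ρ')))|
      ≤ ((n * L : ℕ) : ℝ) ^ 4 * (4 ^ (d + 1) * Kop (d + 1) 2 * ((L : ℝ) ^ (d + 1))⁻¹) * Real.exp (-(kappaB (d + 1) 2 * supNorm (X - Y))) := by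
  have h := subcell_decay n L 2 τ σ (X - Y)
  rw [latticeKernel_avgM] at h
  simp_rw [Sb_finePt]
  have e : ((L : ℝ) ^ (d + 1))⁻¹ * (((L : ℝ) ^ (d + 1))⁻¹ *
      ∑ ρ : Fin (d + 1) → Fin L, ∑ ρ' : Fin (d + 1) → Fin L,
        ((((n * L : ℕ) : ℂ) ^ 4) * latticeKernel (M (n * L) 2 (Tsub n L τ ρ) (Tsub n L σ ρ')) (X - Y)).re)
      = ((((n * L : ℕ) : ℂ) ^ 4) * (((L : ℂ) ^ (d + 1))⁻¹ * ((((L : ℂ) ^ (d + 1))⁻¹ *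
          ∑ ρ : Fin (d + 1) → Fin L, ∑ ρ' : Fin (d + 1) → Fin L, latticeKernel (M (n * L) 2 (Tsub n L τ ρ) (Tsub n L σ ρ')) (X - Y))))).re := by
    simp_rw [← Complex.re_sum, ← Finset.mul_sum]
    have e1 : ((((n * L : ℕ) : ℂ) ^ 4) * (((L : ℂ) ^ (d + 1))⁻¹ * ((((L : ℂ) ^ (d + 1))⁻¹ *
          ∑ ρ : Fin (d + 1) → Fin L, ∑ ρ' : Fin (d + 1) → Fin L, latticeKernel (M (n * L) 2 (Tsub n L τ ρ) (Tsub n L σ ρ')) (X - Y)))))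
        = ((((L : ℝ) ^ (d + 1))⁻¹ * ((L : ℝ) ^ (d + 1))⁻¹ : ℝ) : ℂ) * ((((n * L : ℕ) : ℂ) ^ 4) *
          ∑ ρ : Fin (d + 1) → Fin L, ∑ ρ' : Fin (d + 1) → Fin L, latticeKernel (M (n * L) 2 (Tsub n L τ ρ) (Tsub n L σ ρ')) (X - Y)) := by
      push_cast; ring
    rw [e1, Complex.re_ofReal_mul]
    ring
  rw [e]
  refine (Complex.abs_re_le_norm _).trans ?_
  rw [norm_mul, norm_pow, Complex.norm_natCast, mul_assoc]
  exact mul_le_mul_of_nonneg_left h (by positivity)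

/-- [our proof] **«(CONV-C)-Sb», THE UNIFORM HALF IN `dec` FORM, FOR an2's KERNEL BY NAME**: ONE rate `κ > 0` and ONE constant `C ≥ 0`, free of the
levels, such that for ALL `n, L ≥ 1`, cells `τ, σ` and blocks `X, Y`, the doubly cell-averaged `Sb_{nL}` times `L^{d+1}·((nL):ℝ)^{−4}` is `≤ C·e^{−κ|X−Y|_∞}`. -/
theorem Sb_cell_tower_uniform (d : ℕ) :
    ∃ κ C : ℝ, 0 < κ ∧ 0 ≤ C ∧ ∀ (n L : ℕ) [NeZero n] [NeZero L] [NeZero (n * L)] (X Y : Fin (d + 1) → ℤ) (τ σ : Fin (d + 1) → Fin n),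
      |(L : ℝ) ^ (d + 1) * ((((n * L : ℕ) : ℝ) ^ 4)⁻¹ * (((L : ℝ) ^ (d + 1))⁻¹ * (((L : ℝ) ^ (d + 1))⁻¹ *
        ∑ ρ : Fin (d + 1) → Fin L, ∑ ρ' : Fin (d + 1) → Fin L,
          Sb (N := n * L) (finePt (n * L) X (Tsub n L τ ρ)) (finePt (n * L) Y (Tsub n L σ ρ')))))|
        ≤ C * Real.exp (-(κ * supNorm (X - Y))) := by
  refine ⟨kappaB (d + 1) 2, 4 ^ (d + 1) * Kop (d + 1) 2, kappaB_pos (d + 1) 2, by have := Kop_nonneg (d + 1) 2; positivity,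
    fun n L _ _ _ X Y τ σ => ?_⟩
  have h := abs_cellAvg_Sb_le n L X Y τ σ
  have hL : (0 : ℝ) < (L : ℝ) ^ (d + 1) := by
    have : (0 : ℝ) < L := by exact_mod_cast Nat.pos_of_ne_zero (NeZero.ne L)
    positivity
  have hN : (0 : ℝ) < ((n * L : ℕ) : ℝ) ^ 4 := by
    have : (0 : ℝ) < ((n * L : ℕ) : ℝ) := by exact_mod_cast Nat.pos_of_ne_zero (NeZero.ne (n * L))
    positivity
  rw [abs_mul, abs_mul, abs_of_pos hL, abs_of_pos (inv_pos.mpr hN)]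
  calc (L : ℝ) ^ (d + 1) * ((((n * L : ℕ) : ℝ) ^ 4)⁻¹ * |((L : ℝ) ^ (d + 1))⁻¹ * (((L : ℝ) ^ (d + 1))⁻¹ *
        ∑ ρ : Fin (d + 1) → Fin L, ∑ ρ' : Fin (d + 1) → Fin L,
          Sb (N := n * L) (finePt (n * L) X (Tsub n L τ ρ)) (finePt (n * L) Y (Tsub n L σ ρ')))|)
      ≤ (L : ℝ) ^ (d + 1) * ((((n * L : ℕ) : ℝ) ^ 4)⁻¹ * (((n * L : ℕ) : ℝ) ^ 4 * (4 ^ (d + 1) * Kop (d + 1) 2 * ((L : ℝ) ^ (d + 1))⁻¹) *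
          Real.exp (-(kappaB (d + 1) 2 * supNorm (X - Y))))) :=
        mul_le_mul_of_nonneg_left (mul_le_mul_of_nonneg_left h (by positivity)) hL.le
    _ = 4 ^ (d + 1) * Kop (d + 1) 2 * Real.exp (-(kappaB (d + 1) 2 * supNorm (X - Y))) := by
        have hN0 : (((n * L : ℕ) : ℝ)) ≠ 0 := by exact_mod_cast (NeZero.ne (n * L))
        field_simp


end Summit.QuantumFields.BalabanUV.Beta.FP.ConstrainedBiLaplacianSbCellMajorant

end
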